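import Literature.AlgebraicGeometry.Surfaces.K3LatticeFourierMukaiNumber
import Literature.Topology.FourManifolds.LatticeFormsDiscriminantFormLifting
import Literature.Topology.FourManifolds.LatticeFormsMilnorClassification
import HarnessLib

/-!
# The index of the stable orthogonal group: `[O(L) : Õ(L)] = |O(q_L)|` for even lattices containing `U`,
# `|O(q_{⟨−2d⟩})| = |O(q_{Λ_d})| = 2^{ρ(d)}`, hence `[O(Λ_d) : Õ(Λ_d)] = 2^{ρ(d)}` for `Λ_d = L_{2d} = ℓ^⊥ ⊂ Λ_{K3}`
# (Gritsenko–Hulek–Sankaran, *The Hirzebruch–Mumford volume for the orthogonal group*, Lemmas 4.2 and 4.3)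

Trunk T-4MAN vocabulary; sequel of `LatticeFormsStableOrthogonalGroup.lean` (Huybrechts Cor. 14.2.7:
`Õ(ℓ^⊥) = {g | ḡ = id} = {g|_{ℓ^⊥} : g ∈ O(Λ), g ℓ = ℓ}`, no count), of `LatticeFormsDiscriminantFormLifting.lean`
(Thm. 14.2.4 for `U`-split lattices: `O(L) ↠ O(q_L)`), of `LatticeFormsRankOneDiscriminantFormIsometries.lean`
(`|O(q_{ℤ(2d)})| = 2^{ω(d)}`) and of `AlgebraicGeometry/Surfaces/K3LatticeFourierMukaiNumber.lean` (`Λ|_{ℤℓ} ≅ ℤ(2d)`).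
Written for lane `lit-hodgefound` (Track 2 foundations; prover seat `lit-hodgefound-p18`, gen 39, row g39-#3).
THEOREMS ONLY — no definition, no named fact, no instance, no notation. `O(q_L)` is typed as in
`LatticeFormsPrimitiveEmbeddingsCounting` §5 (`{σ : A_L ≃ₗ[ℤ] A_L // ∀ a, q_L (σ a) = q_L a}`); the classes
`O(L) ∕ Õ(L)` are rendered as `Quot (fun g g' : O(L) ↦ ḡ = ḡ')` (§3: `ḡ = ḡ' ⟺ (g⁻¹g')‾ = id`, i.e. `g' ∈ gÕ(L)`),
so no group-structure instance is declared; `⟨−2d⟩ = (−(2d)) • LinearMap.mul ℤ ℤ`; `L_{2d}` is the model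
`((pi fun _ : Fin 2 ↦ -e8Form).prod (hyperbolicSum 2)).prod ((-(2d)) • LinearMap.mul ℤ ℤ)` of
`K3LatticePolarizationClasses` (`≅ ℓ^⊥` for primitive `ℓ ∈ Λ_{K3}` with `(ℓ)² = 2d`, Huybrechts Ex. 14.1.11 (i)).

## Source, verbatim (V. Gritsenko, K. Hulek, G. K. Sankaran, *The Hirzebruch–Mumford volume for the orthogonal
## group and applications*, Doc. Math. 12 (2007) 215–241 = arXiv:math/0512595; held text `paper:arxiv-math_0512595`)

* §4 (p. 9): "By `O(q_L)` we denote the corresponding group of isometries and the group `Õ(L)`, called the stable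
  orthogonal group, is defined as the kernel of the natural homomorphism `O(L) → O(q_L)`. Since `L` contains a
  hyperbolic plane, it follows from [N-int] that this map is surjective."
* "**Lemma 4.2.** Let `N = |O(q_L)|`. Then we have the following diagram of groups with indices as indicated:
  `Õ(L) ⊂ O(L)` [`N:1`], `Õ⁺(L) ⊂ O⁺(L)` [`N:1`], `S̃O⁺(L) ⊂ SO⁺(L)` [`N:1`] (vertical inclusions `2:1`). *Proof.*
  […] We have already observed that the natural map `O(L) → O(q_L)` is surjective, which shows that the top
  horizontal inclusion has index `N`. […] `N = [O(L) : Õ(L)] = [O⁺(L) : Õ⁺(L)] = [SO⁺(L) : S̃O⁺(L)]`."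
* (p. 11) "**Lemma 4.3.** Let `R = ⟨−2d⟩`. Then the order of the discriminant group `O(q_R)` is `2^{ρ(d)}`. *Proof.*
  Let `g` be the standard generator of `A_R = ℤ/2dℤ` […] `q_R(g) = −1/2d mod 2ℤ`. If `φ ∈ O(q_R)`, then `φ(g) = xg`
  for some `x` with `(x, 2d) = 1`. Hence `φ` is orthogonal if and only if `−x²/2d ≡ −1/2d mod 2ℤ`, or equivalently
  `x² ≡ 1 mod 4dℤ`. It is not difficult to check that this equation has `2^{ρ(d)+1}` solutions modulo `4dℤ`, and
  hence `2^{ρ(d)}` solutions modulo `2dℤ`. □ From this it follows also that `|A_{L_{2d}}| = 2^{ρ(d)}`" [read: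
  `|O(A_{L_{2d}})|`] "[…] `[PO(L_{2d}) : PÕ⁺(L_{2d})] = 2^{ρ(d)}` if `d > 1` and `2` if `d = 1`." Here
  `L_{2d} = ⟨−2d⟩ ⊕ 2U ⊕ 2E₈(−1) ≅ h^⊥_{L_{K3}}` (§1 of the paper) and "`ρ(d)` denotes the number of prime divisors of
  `d`".

## Contents (all proved)

* §1 conjugation `σ ↦ φσφ⁻¹` along an anti-isometry or an isometry `φ` of finite quadratic forms is a bijection of
  orthogonal groups: `natCard_discriminantIsometry_eq_of_antiIsometry`, `…_of_discriminantIsometry`,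
  `…_of_isometryEquiv` (isometric lattices have `|O(q)|` equal).
* §2 **Lemma 4.3**: `(A_{ℤ(2d)}, q) ⥲ (A_{⟨−2d⟩}, −q)` (`exists_antiIsometry_twoMul_smul_mul_neg`),
  **`natCard_discriminantIsometry_neg_twoMul_smul_mul : |O(q_{⟨−2d⟩})| = 2 ^ d.primeFactors.card`**; for a primitive
  `ℓ` with `(ℓ)² = 2d > 0` in an even unimodular `Λ`: `(A_{ℤ(2d)}, q) ⥲ (A_{ℓ^⊥}, −q)`
  (`exists_antiIsometry_twoMul_smul_mul_restrict_orthogonal`, Huybrechts Prop. 14.0.2) and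
  **`natCard_discriminantIsometry_restrict_orthogonal : |O(A_{ℓ^⊥}, q)| = 2 ^ d.primeFactors.card`**.
* §3 **Lemma 4.2, top row**, for an even nondegenerate `L ≅ Q ⊕ U^{⊕ r}` (`r ≥ 1`):
  `discriminantGroupCongr_eq_iff` (`ḡ = ḡ' ⟺ (g⁻¹g')‾ = id`) and
  **`natCard_quot_isometryEquiv_eq_natCard_discriminantIsometry : |O(L) ∕ Õ(L)| = |O(q_L)|`**.
* §4 `L_{2d}`: `L_{2d} ≅ (⟨−2d⟩ ⊕ E₈(−1)^{⊕2}) ⊕ U^{⊕2}` (`latticeL2d_equivalent_prod_hyperbolicSum`),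
  **`natCard_quot_isometryEquiv_k3Lattice_orthogonal : [O(ℓ^⊥) : Õ(ℓ^⊥)] = 2 ^ d.primeFactors.card`** for every
  primitive `ℓ ∈ Λ_{K3}` with `(ℓ)² = 2d > 0`, `natCard_discriminantIsometry_latticeL2d` (`|O(q_{L_{2d}})| = 2^{ρ(d)}`)
  and **`natCard_quot_isometryEquiv_latticeL2d : [O(L_{2d}) : Õ(L_{2d})] = 2 ^ d.primeFactors.card`**.

NOT here: the rows of Lemma 4.2 involving `O⁺` and `SO⁺` (the real spinor norm `sn_{−1}` is not in the tree), the
projective statement `[PO(L_{2d}) : PÕ⁺(L_{2d})]`, and the Hirzebruch–Mumford volumes.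

## References

* [GritsenkoHulekSankaran2007HM] V. Gritsenko, K. Hulek, G. K. Sankaran, The Hirzebruch–Mumford volume for the
  orthogonal group and applications, Doc. Math. 12 (2007) 215–241 (arXiv:math/0512595): §4 Lemma 4.2, Lemma 4.3.
* [Huybrechts2016K3] D. Huybrechts, Lectures on K3 Surfaces, CUP 2016, Ch. 6 §3.2; Ch. 14 §0.2 Prop. 0.2, §0.3 (iv),
  Example 1.11 (i), Thm. 2.4, Cor. 2.7.
* [Nikulin1980] V. V. Nikulin, Integral symmetric bilinear forms and some of their applications, Math. USSR Izv. 14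
  (1980) 103–167: Prop. 1.6.1, Thm. 1.14.2.
* [HosonoLianOguisoYau2004] S. Hosono, B. H. Lian, K. Oguiso, S.-T. Yau, Fourier–Mukai number of a K3 surface,
  App. A Lemma A.5 (conjugation by a fixed `φ_j`).
-/

noncomputable section

open Module Function
open LinearMap (BilinForm)
open LinearMap.BilinForm
open Literature.AlgebraicGeometry.Surfaces

namespace Literature.Topology.FourManifolds

universe u w w'

/-! ### §1 Conjugating `O(A, q)` along an isometry or anti-isometry of finite quadratic forms -/

section Conjugation

variable {P : Type w} [AddCommGroup P] [Module.Finite ℤ P] [Module.Free ℤ P] (C : BilinForm ℤ P)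
  {Q : Type w'} [AddCommGroup Q] [Module.Finite ℤ Q] [Module.Free ℤ Q] (D : BilinForm ℤ Q)

/-- **`O(q) ≅ O(−q')` along an anti-isometry**: if `φ : (A_T, q_T) ⥲ (A_S, −q_S)`, then `σ ↦ φ σ φ⁻¹` is a
bijection `O(A_T, q_T) ⥲ O(A_S, q_S)`; in particular the two groups have the same order (used with GHS's
`A_{L_{2d}} ≅ A_{⟨−2d⟩}`: "From this it follows also that `|O(A_{L_{2d}})| = 2^{ρ(d)}`").
[cite: GritsenkoHulekSankaran2007HM, §4 after Lemma 4.3] [cite: HosonoLianOguisoYau2004, App. A Lemma A.5] -/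
theorem natCard_discriminantIsometry_eq_of_antiIsometry (hC : C.Nondegenerate) (hs : C.IsSymm) (he : C.IsEven)
    (hD : D.Nondegenerate) (hsD : D.IsSymm) (heD : D.IsEven) (φ : C.discriminantGroup ≃ₗ[ℤ] D.discriminantGroup)
    (hφ : ∀ a, D.discriminantQuad hD hsD heD (φ a) = -C.discriminantQuad hC hs he a) :
    Nat.card {σ : C.discriminantGroup ≃ₗ[ℤ] C.discriminantGroup //
        ∀ a, C.discriminantQuad hC hs he (σ a) = C.discriminantQuad hC hs he a} =
      Nat.card {τ : D.discriminantGroup ≃ₗ[ℤ] D.discriminantGroup //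
        ∀ b, D.discriminantQuad hD hsD heD (τ b) = D.discriminantQuad hD hsD heD b} := by
  have hφ' : ∀ b, C.discriminantQuad hC hs he (φ.symm b) = -D.discriminantQuad hD hsD heD b := fun b ↦ by
    rw [eq_neg_iff_add_eq_zero, ← neg_eq_iff_add_eq_zero, ← hφ, LinearEquiv.apply_symm_apply]
  exact Nat.card_congr
    { toFun := fun σ ↦ ⟨(φ.symm.trans σ.1).trans φ, fun b ↦ by
        rw [LinearEquiv.trans_apply, LinearEquiv.trans_apply, hφ, σ.2, hφ', neg_neg]⟩
      invFun := fun τ ↦ ⟨(φ.trans τ.1).trans φ.symm, fun a ↦ by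
        rw [LinearEquiv.trans_apply, LinearEquiv.trans_apply, hφ', τ.2, hφ, neg_neg]⟩
      left_inv := fun σ ↦ Subtype.ext (LinearEquiv.ext fun a ↦ by simp)
      right_inv := fun τ ↦ Subtype.ext (LinearEquiv.ext fun b ↦ by simp) }

/-- **`O(q) ≅ O(q')` along an isometry** `φ : (A_T, q_T) ⥲ (A_S, q_S)` (e.g. `φ = ḡ` for an isometry of
lattices `g : T ⥲ S`): `σ ↦ φ σ φ⁻¹`. [cite: GritsenkoHulekSankaran2007HM, §4 Lemma 4.2 ("`N = |O(q_L)|`", an invariant of the isometry class)] -/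
theorem natCard_discriminantIsometry_eq_of_discriminantIsometry (hC : C.Nondegenerate) (hs : C.IsSymm)
    (he : C.IsEven) (hD : D.Nondegenerate) (hsD : D.IsSymm) (heD : D.IsEven)
    (φ : C.discriminantGroup ≃ₗ[ℤ] D.discriminantGroup)
    (hφ : ∀ a, D.discriminantQuad hD hsD heD (φ a) = C.discriminantQuad hC hs he a) :
    Nat.card {σ : C.discriminantGroup ≃ₗ[ℤ] C.discriminantGroup //
        ∀ a, C.discriminantQuad hC hs he (σ a) = C.discriminantQuad hC hs he a} =
      Nat.card {τ : D.discriminantGroup ≃ₗ[ℤ] D.discriminantGroup //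
        ∀ b, D.discriminantQuad hD hsD heD (τ b) = D.discriminantQuad hD hsD heD b} := by
  have hφ' : ∀ b, C.discriminantQuad hC hs he (φ.symm b) = D.discriminantQuad hD hsD heD b := fun b ↦ by
    rw [← hφ, LinearEquiv.apply_symm_apply]
  exact Nat.card_congr
    { toFun := fun σ ↦ ⟨(φ.symm.trans σ.1).trans φ, fun b ↦ by
        rw [LinearEquiv.trans_apply, LinearEquiv.trans_apply, hφ, σ.2, hφ']⟩
      invFun := fun τ ↦ ⟨(φ.trans τ.1).trans φ.symm, fun a ↦ by
        rw [LinearEquiv.trans_apply, LinearEquiv.trans_apply, hφ', τ.2, hφ]⟩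
      left_inv := fun σ ↦ Subtype.ext (LinearEquiv.ext fun a ↦ by simp)
      right_inv := fun τ ↦ Subtype.ext (LinearEquiv.ext fun b ↦ by simp) }

/-- Isometric even lattices have discriminant-form orthogonal groups of the same order.
[cite: GritsenkoHulekSankaran2007HM, §4 Lemma 4.2] -/
theorem natCard_discriminantIsometry_eq_of_isometryEquiv (g : C.IsometryEquiv D) (hC : C.Nondegenerate)
    (hs : C.IsSymm) (he : C.IsEven) (hD : D.Nondegenerate) (hsD : D.IsSymm) (heD : D.IsEven) :
    Nat.card {σ : C.discriminantGroup ≃ₗ[ℤ] C.discriminantGroup //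
        ∀ a, C.discriminantQuad hC hs he (σ a) = C.discriminantQuad hC hs he a} =
      Nat.card {τ : D.discriminantGroup ≃ₗ[ℤ] D.discriminantGroup //
        ∀ b, D.discriminantQuad hD hsD heD (τ b) = D.discriminantQuad hD hsD heD b} :=
  natCard_discriminantIsometry_eq_of_discriminantIsometry C D hC hs he hD hsD heD g.discriminantGroupCongr
    fun a ↦ g.discriminantQuad_discriminantGroupCongr hC hs he hD hsD heD a

end Conjugation

/-! ### §2 GHS Lemma 4.3: `|O(q_{⟨−2d⟩})| = 2^{ρ(d)}`, and `|O(A_{ℓ^⊥}, q)| = 2^{ρ(d)}` for primitive `ℓ`, `(ℓ)² = 2d` -/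

section RankOne

variable (d : ℕ)

/-- **`(A_{ℤ(2d)}, q) ≃ (A_{⟨−2d⟩}, −q)`**: `⟨−2d⟩ = ℤ(2d)(−1)` has the same dual quotient with the opposite form
(`q_{⟨−2d⟩}(g) = −1/2d`). [cite: GritsenkoHulekSankaran2007HM, §4 proof of Lemma 4.3 ("`q_R(g) = −1/2d mod 2ℤ`")] [cite: Huybrechts2016K3, Ch. 14 §0.3 (iv)] -/
theorem exists_antiIsometry_twoMul_smul_mul_neg (hd : 0 < d)
    (h₁ : BilinForm.Nondegenerate ((2 * d : ℤ) • LinearMap.mul ℤ ℤ))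
    (h₂ : BilinForm.IsSymm ((2 * d : ℤ) • LinearMap.mul ℤ ℤ)) (h₃ : BilinForm.IsEven ((2 * d : ℤ) • LinearMap.mul ℤ ℤ))
    (h₁' : BilinForm.Nondegenerate ((-(2 * d : ℤ)) • LinearMap.mul ℤ ℤ))
    (h₂' : BilinForm.IsSymm ((-(2 * d : ℤ)) • LinearMap.mul ℤ ℤ))
    (h₃' : BilinForm.IsEven ((-(2 * d : ℤ)) • LinearMap.mul ℤ ℤ)) :
    ∃ φ : BilinForm.discriminantGroup ((2 * d : ℤ) • LinearMap.mul ℤ ℤ) ≃ₗ[ℤ]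
        BilinForm.discriminantGroup ((-(2 * d : ℤ)) • LinearMap.mul ℤ ℤ),
      ∀ a, BilinForm.discriminantQuad ((-(2 * d : ℤ)) • LinearMap.mul ℤ ℤ) h₁' h₂' h₃' (φ a) =
        -BilinForm.discriminantQuad ((2 * d : ℤ) • LinearMap.mul ℤ ℤ) h₁ h₂ h₃ a := by
  have hr : LinearMap.range ((2 * d : ℤ) • LinearMap.mul ℤ ℤ) =
      LinearMap.range ((-(2 * d : ℤ)) • LinearMap.mul ℤ ℤ) := by
    rw [neg_smul, LinearMap.range_neg]
  refine ⟨Submodule.quotEquivOfEq _ _ hr, fun a ↦ ?_⟩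
  obtain ⟨f, rfl⟩ := BilinForm.discriminantGroup_mk_surjective ((2 * d : ℤ) • LinearMap.mul ℤ ℤ) a
  change BilinForm.discriminantQuad ((-(2 * d : ℤ)) • LinearMap.mul ℤ ℤ) h₁' h₂' h₃' (Submodule.Quotient.mk f) =
    -BilinForm.discriminantQuad ((2 * d : ℤ) • LinearMap.mul ℤ ℤ) h₁ h₂ h₃ (Submodule.Quotient.mk f)
  rw [discriminantQuad_mk, discriminantQuad_mk,
    dualForm_smul (LinearMap.mul ℤ ℤ) nondegenerate_mul (by positivity : (2 * d : ℤ) ≠ 0),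
    dualForm_smul (LinearMap.mul ℤ ℤ) nondegenerate_mul (by omega : (-(2 * d : ℤ)) ≠ 0), ← AddCircle.coe_neg]
  congr 1
  push_cast
  rw [inv_neg, neg_mul]

/-- `⟨−2d⟩` is a nondegenerate symmetric even lattice (`d ≥ 1`). [cite: GritsenkoHulekSankaran2007HM, §4 Lemma 4.3 ("`R = ⟨−2d⟩`")] -/
theorem nondegenerate_isSymm_isEven_neg_twoMul_smul_mul (hd : 0 < d) :
    BilinForm.Nondegenerate ((-(2 * d : ℤ)) • LinearMap.mul ℤ ℤ) ∧
      BilinForm.IsSymm ((-(2 * d : ℤ)) • LinearMap.mul ℤ ℤ) ∧ BilinForm.IsEven ((-(2 * d : ℤ)) • LinearMap.mul ℤ ℤ) :=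
  ⟨(nondegenerate_zsmul_iff _ (by omega)).2 nondegenerate_mul, isSymm_smul_mul _,
    fun x ↦ ⟨-(d * (x * x)), by rw [smul_mul_apply]; ring⟩⟩

/-- **GHS Lemma 4.3: `|O(q_R)| = 2^{ρ(d)}` for `R = ⟨−2d⟩`** (`ρ(d)` = the number of prime divisors of `d`;
"`φ(g) = xg` … `x² ≡ 1 mod 4dℤ` … `2^{ρ(d)+1}` solutions modulo `4dℤ`, and hence `2^{ρ(d)}` solutions modulo `2dℤ`").
[cite: GritsenkoHulekSankaran2007HM, §4 Lemma 4.3] -/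
theorem natCard_discriminantIsometry_neg_twoMul_smul_mul (hd : 0 < d)
    (h₁' : BilinForm.Nondegenerate ((-(2 * d : ℤ)) • LinearMap.mul ℤ ℤ))
    (h₂' : BilinForm.IsSymm ((-(2 * d : ℤ)) • LinearMap.mul ℤ ℤ))
    (h₃' : BilinForm.IsEven ((-(2 * d : ℤ)) • LinearMap.mul ℤ ℤ)) :
    Nat.card {τ : BilinForm.discriminantGroup ((-(2 * d : ℤ)) • LinearMap.mul ℤ ℤ) ≃ₗ[ℤ]
        BilinForm.discriminantGroup ((-(2 * d : ℤ)) • LinearMap.mul ℤ ℤ) //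
        ∀ b, BilinForm.discriminantQuad ((-(2 * d : ℤ)) • LinearMap.mul ℤ ℤ) h₁' h₂' h₃' (τ b) =
          BilinForm.discriminantQuad ((-(2 * d : ℤ)) • LinearMap.mul ℤ ℤ) h₁' h₂' h₃' b} = 2 ^ d.primeFactors.card := by
  obtain ⟨φ, hφ⟩ := exists_antiIsometry_twoMul_smul_mul_neg d hd (nondegenerate_twoMul_smul_mul d hd)
    (isSymm_twoMul_smul_mul d) (isEven_twoMul_smul_mul d) h₁' h₂' h₃'
  rw [← natCard_discriminantIsometry_eq_of_antiIsometry _ _ _ _ _ h₁' h₂' h₃' φ hφ,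
    natCard_discriminantIsometry_twoMul_smul_mul d hd]

variable {V : Type u} [AddCommGroup V] [Module.Finite ℤ V] [Module.Free ℤ V] (Λ : BilinForm ℤ V)

/-- **`(A_{ℤ(2d)}, q) ⥲ (A_{ℓ^⊥}, −q)`** for a primitive `ℓ` with `(ℓ)² = 2d ≠ 0` in an even unimodular lattice:
`ℤ(2d) ≅ ℤℓ` (`aℓ ↦ a`) followed by Huybrechts' Prop. 0.2 anti-isometry `A_{ℤℓ} ⥲ A_{(ℤℓ)^⊥}` — GHS's
"`A_{L_{2d}}` with `q = q_{⟨−2d⟩}`" for `ℓ^⊥ ≅ L_{2d}`.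
[cite: GritsenkoHulekSankaran2007HM, §4 after Lemma 4.3] [cite: Huybrechts2016K3, Ch. 14 §0.2 Prop. 0.2 (i)] -/
theorem exists_antiIsometry_twoMul_smul_mul_restrict_orthogonal (hs : Λ.IsSymm) (hu : Λ.IsUnimodular)
    (he : Λ.IsEven) (hd : 0 < d) {ℓ : V} (hℓ : Λ ℓ ℓ = 2 * d)
    (hℓsat : ∀ (k : ℤ) (w : V), k ≠ 0 → k • w ∈ ℤ ∙ ℓ → w ∈ ℤ ∙ ℓ)
    (h₁ : BilinForm.Nondegenerate ((2 * d : ℤ) • LinearMap.mul ℤ ℤ))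
    (h₂ : BilinForm.IsSymm ((2 * d : ℤ) • LinearMap.mul ℤ ℤ)) (h₃ : BilinForm.IsEven ((2 * d : ℤ) • LinearMap.mul ℤ ℤ))
    (hC : (Λ.restrict (Λ.orthogonal (ℤ ∙ ℓ))).Nondegenerate) (hsC : (Λ.restrict (Λ.orthogonal (ℤ ∙ ℓ))).IsSymm)
    (heC : (Λ.restrict (Λ.orthogonal (ℤ ∙ ℓ))).IsEven) :
    ∃ φ : BilinForm.discriminantGroup ((2 * d : ℤ) • LinearMap.mul ℤ ℤ) ≃ₗ[ℤ]
        (Λ.restrict (Λ.orthogonal (ℤ ∙ ℓ))).discriminantGroup,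
      ∀ a, (Λ.restrict (Λ.orthogonal (ℤ ∙ ℓ))).discriminantQuad hC hsC heC (φ a) =
        -BilinForm.discriminantQuad ((2 * d : ℤ) • LinearMap.mul ℤ ℤ) h₁ h₂ h₃ a := by
  haveI : Λ.IsPerfPair := hu
  have hℓ0 : ℓ ≠ 0 := by
    intro h0
    subst h0
    simp only [map_zero] at hℓ
    omega
  have hℓ0' : Λ ℓ ℓ ≠ 0 := by rw [hℓ]; positivity
  have hnd : (Λ.restrict (ℤ ∙ ℓ)).Nondegenerate := nondegenerate_restrict_span_singleton Λ hℓ0'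
  obtain ⟨ψ⟩ := restrict_span_singleton_equivalent_smul_mul Λ hℓ0
  rw [hℓ] at ψ
  -- `ψ : Λ|_{ℤℓ} ≅ ℤ(2d)`; `ψ⁻¹‾ : A_{ℤ(2d)} ⥲ A_{ℤℓ}` is an isometry, `e : A_{ℤℓ} ⥲ A_{ℓ^⊥}` an anti-isometry
  obtain ⟨e, -, -, he'⟩ := exists_discriminantGroup_antiIsometry Λ (ℤ ∙ ℓ) hs he hℓsat hnd
  refine ⟨ψ.symm.discriminantGroupCongr.trans e, fun a ↦ ?_⟩
  rw [LinearEquiv.trans_apply, he', ψ.symm.discriminantQuad_discriminantGroupCongr h₁ h₂ h₃ hnd (hs.restrict _)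
    (isEven_restrict he _)]

/-- **`|O(A_{ℓ^⊥}, q)| = 2^{ρ(d)}`** for a primitive `ℓ` with `(ℓ)² = 2d > 0` in an even unimodular lattice `Λ` — for
`Λ = Λ_{K3}`: `|O(A_{L_{2d}})| = |O(q_{⟨−2d⟩})| = 2^{ρ(d)}` ("From this it follows also that …").
[cite: GritsenkoHulekSankaran2007HM, §4 Lemma 4.3 and the line after it] -/
theorem natCard_discriminantIsometry_restrict_orthogonal (hs : Λ.IsSymm) (hu : Λ.IsUnimodular) (he : Λ.IsEven)
    (hd : 0 < d) {ℓ : V} (hℓ : Λ ℓ ℓ = 2 * d) (hℓsat : ∀ (k : ℤ) (w : V), k ≠ 0 → k • w ∈ ℤ ∙ ℓ → w ∈ ℤ ∙ ℓ)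
    (hC : (Λ.restrict (Λ.orthogonal (ℤ ∙ ℓ))).Nondegenerate) (hsC : (Λ.restrict (Λ.orthogonal (ℤ ∙ ℓ))).IsSymm)
    (heC : (Λ.restrict (Λ.orthogonal (ℤ ∙ ℓ))).IsEven) :
    Nat.card {τ : (Λ.restrict (Λ.orthogonal (ℤ ∙ ℓ))).discriminantGroup ≃ₗ[ℤ]
        (Λ.restrict (Λ.orthogonal (ℤ ∙ ℓ))).discriminantGroup //
        ∀ b, (Λ.restrict (Λ.orthogonal (ℤ ∙ ℓ))).discriminantQuad hC hsC heC (τ b) =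
          (Λ.restrict (Λ.orthogonal (ℤ ∙ ℓ))).discriminantQuad hC hsC heC b} = 2 ^ d.primeFactors.card := by
  obtain ⟨φ, hφ⟩ := exists_antiIsometry_twoMul_smul_mul_restrict_orthogonal d Λ hs hu he hd hℓ hℓsat
    (nondegenerate_twoMul_smul_mul d hd) (isSymm_twoMul_smul_mul d) (isEven_twoMul_smul_mul d) hC hsC heC
  rw [← natCard_discriminantIsometry_eq_of_antiIsometry _ _ _ _ _ hC hsC heC φ hφ,
    natCard_discriminantIsometry_twoMul_smul_mul d hd]

end RankOne

/-! ### §3 GHS Lemma 4.2 (top row): for `L ⊇ U`, the cosets of `Õ(L) = ker (O(L) → O(q_L))` correspond to `O(q_L)` -/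

section StableIndex

variable {M : Type u} [AddCommGroup M] [Module.Finite ℤ M] [Module.Free ℤ M] (B : BilinForm ℤ M)

omit [Module.Finite ℤ M] [Module.Free ℤ M] in
/-- **`ḡ = ḡ'` iff `(g⁻¹g')‾ = id`**: two isometries have the same image in `O(q_L)` iff they differ by an element
of the stable orthogonal group `Õ(L) = {h ∈ O(L) | h̄ = id}` — the classes of `O(L)` under "`ḡ = ḡ'`" are the
cosets `g·Õ(L)`. [cite: GritsenkoHulekSankaran2007HM, §4 ("`Õ(L)` … is defined as the kernel of the natural homomorphism `O(L) → O(q_L)`")] [cite: Huybrechts2016K3, Ch. 6 §3.2 ("`Õ(Λ_d)` is the subgroup of `O(Λ_d)` of all isometries acting trivially on the discriminant")] -/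
theorem discriminantGroupCongr_eq_iff (g g' : B.IsometryEquiv B) :
    g.discriminantGroupCongr = g'.discriminantGroupCongr ↔
      (g.symm.trans g').discriminantGroupCongr = LinearEquiv.refl ℤ B.discriminantGroup := by
  rw [IsometryEquiv.discriminantGroupCongr_trans, IsometryEquiv.discriminantGroupCongr_symm]
  constructor
  · intro h
    rw [h, LinearEquiv.symm_trans_self]
  · intro h
    refine LinearEquiv.ext fun a ↦ ?_
    have h1 := LinearEquiv.congr_fun h (g.discriminantGroupCongr a)
    rw [LinearEquiv.trans_apply, LinearEquiv.symm_apply_apply, LinearEquiv.refl_apply] at h1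
    exact h1.symm

/-- **GHS Lemma 4.2, top row: `[O(L) : Õ(L)] = N = |O(q_L)|`** for an even nondegenerate lattice `L ≅ Q ⊕ U^{⊕ r}`
(`r ≥ 1`, "`L` contains a hyperbolic plane"): the classes of isometries of `L` with the same action on the
discriminant group (= the cosets of the stable orthogonal group) are in bijection with `O(q_L)` — injectively by
construction, surjectively because "since `L` contains a hyperbolic plane, it follows from [N-int] that this map is
surjective" (the tree's Thm. 14.2.4 for `U`-split lattices, `LatticeFormsDiscriminantFormLifting`).
[cite: GritsenkoHulekSankaran2007HM, §4 Lemma 4.2 ("`N = [O(L) : Õ(L)]`")] [cite: Nikulin1980, Thm. 1.14.2] [cite: Huybrechts2016K3, Ch. 14 Thm. 2.4] -/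
theorem natCard_quot_isometryEquiv_eq_natCard_discriminantIsometry (hB : B.Nondegenerate) (hs : B.IsSymm)
    (he : B.IsEven) {N : Type w} [AddCommGroup N] [Module.Finite ℤ N] [Module.Free ℤ N] (Q : BilinForm ℤ N)
    (hQ : Q.Nondegenerate) (hsQ : Q.IsSymm) (heQ : Q.IsEven) {r : ℕ} (hr : 0 < r)
    (hBQ : B.Equivalent (Q.prod (hyperbolicSum r))) :
    Nat.card (Quot (fun g g' : B.IsometryEquiv B ↦ g.discriminantGroupCongr = g'.discriminantGroupCongr)) =
      Nat.card {σ : B.discriminantGroup ≃ₗ[ℤ] B.discriminantGroup //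
        ∀ a, B.discriminantQuad hB hs he (σ a) = B.discriminantQuad hB hs he a} := by
  refine Nat.card_eq_of_bijective
    (Quot.lift (fun g : B.IsometryEquiv B ↦ (⟨g.discriminantGroupCongr,
        fun a ↦ g.discriminantQuad_discriminantGroupCongr hB hs he hB hs he a⟩ :
        {σ : B.discriminantGroup ≃ₗ[ℤ] B.discriminantGroup //
          ∀ a, B.discriminantQuad hB hs he (σ a) = B.discriminantQuad hB hs he a}))
      (fun g g' h ↦ Subtype.ext h)) ⟨?_, ?_⟩
  · rintro ⟨g⟩ ⟨g'⟩ h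
    exact Quot.sound (Subtype.ext_iff.1 h)
  · intro σ
    obtain ⟨g, hg⟩ := exists_isometryEquiv_discriminantGroupCongr_eq_of_equivalent_prod_hyperbolicSum B Q hB hs he
      hQ hsQ heQ hr hBQ σ.1 σ.2
    exact ⟨Quot.mk _ g, Subtype.ext (LinearEquiv.ext hg)⟩

end StableIndex

/-! ### §4 `L_{2d} = Λ_d = ℓ^⊥ ⊂ Λ_{K3}`: `[O(Λ_d) : Õ(Λ_d)] = |O(q_{Λ_d})| = 2^{ρ(d)}` -/

section K3

variable (d : ℕ)

/-- `⟨−2d⟩ ⊕ E₈(−1)^{⊕ 2}` is a nondegenerate symmetric even lattice (`d ≥ 1`). [cite: GritsenkoHulekSankaran2007HM, §4 ("`L_{2d} = ⟨−2d⟩ ⊕ 2U ⊕ 2E₈(−1)`")] -/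
theorem nondegenerate_isSymm_isEven_neg_twoMul_smul_mul_prod_pi_neg_e8Form (hd : 0 < d) :
    (BilinForm.prod ((-(2 * d : ℤ)) • LinearMap.mul ℤ ℤ) (pi fun _ : Fin 2 ↦ -e8Form)).Nondegenerate ∧
      (BilinForm.prod ((-(2 * d : ℤ)) • LinearMap.mul ℤ ℤ) (pi fun _ : Fin 2 ↦ -e8Form)).IsSymm ∧
        (BilinForm.prod ((-(2 * d : ℤ)) • LinearMap.mul ℤ ℤ) (pi fun _ : Fin 2 ↦ -e8Form)).IsEven := by
  obtain ⟨hR, hsR, heR⟩ := nondegenerate_isSymm_isEven_neg_twoMul_smul_mul d hd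
  obtain ⟨hsP, heP, huP⟩ := isSymm_isEven_isUnimodular_pi_neg_e8Form (m := 2)
  exact ⟨hR.prod huP.nondegenerate, hsR.prod hsP, isEven_prod_iff.2 ⟨heR, heP⟩⟩

/-- **`L_{2d} ≅ (⟨−2d⟩ ⊕ E₈(−1)^{⊕2}) ⊕ U^{⊕2}`**: the model `(E₈(−1)^{⊕2} ⊕ U^{⊕2}) ⊕ ℤ(−2d)` of
`K3LatticePolarizationClasses` rebracketed so that the hyperbolic planes split off ("`L` contains a hyperbolic plane").
[cite: GritsenkoHulekSankaran2007HM, §4 ("`L_{2d} = ⟨−2d⟩ ⊕ 2U ⊕ 2E₈(−1)`")] -/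
theorem latticeL2d_equivalent_prod_hyperbolicSum :
    ((((LinearMap.BilinForm.pi fun _ : Fin 2 ↦ -e8Form).prod (hyperbolicSum 2)).prod
        ((-(2 * d : ℤ)) • LinearMap.mul ℤ ℤ))).Equivalent
      ((BilinForm.prod ((-(2 * d : ℤ)) • LinearMap.mul ℤ ℤ) (pi fun _ : Fin 2 ↦ -e8Form)).prod (hyperbolicSum 2)) :=
  ⟨(IsometryEquiv.prodComm _ _).trans
    (IsometryEquiv.prodAssoc ((-(2 * d : ℤ)) • LinearMap.mul ℤ ℤ) (pi fun _ : Fin 2 ↦ -e8Form) (hyperbolicSum 2)).symm⟩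

/-- **`[O(Λ_d) : Õ(Λ_d)] = 2^{ρ(d)}` for `Λ_d = ℓ^⊥ ⊂ Λ_{K3}`** (`ℓ` primitive, `(ℓ)² = 2d > 0`): the classes of
`O(ℓ^⊥)` with the same action on `A_{ℓ^⊥}` number `|O(q_{ℓ^⊥})| = |O(q_{⟨−2d⟩})| = 2^{ρ(d)}` (`ℓ^⊥ ≅ L_{2d}` contains
`U^{⊕2}`, so `O(ℓ^⊥) → O(q)` is onto). GHS: "`N = [O(L) : Õ(L)]`", `N = |O(q_{L_{2d}})| = 2^{ρ(d)}`.
[cite: GritsenkoHulekSankaran2007HM, §4 Lemma 4.2, Lemma 4.3 ("`[PO(L_{2d}) : PÕ^+(L_{2d})] = 2^{ρ(d)}` if `d > 1`")] [cite: Huybrechts2016K3, Ch. 6 §3.2, Ch. 14 Cor. 2.7] -/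
theorem natCard_quot_isometryEquiv_k3Lattice_orthogonal (hd : 0 < d) {ℓ : K3Index → ℤ}
    (hℓ : Matrix.toBilin' k3Gram ℓ ℓ = 2 * d)
    (hℓsat : ∀ (k : ℤ) (w : K3Index → ℤ), k ≠ 0 → k • w ∈ ℤ ∙ ℓ → w ∈ ℤ ∙ ℓ) :
    Nat.card (Quot (fun g g' : ((Matrix.toBilin' k3Gram).restrict ((Matrix.toBilin' k3Gram).orthogonal (ℤ ∙ ℓ))).IsometryEquiv
        ((Matrix.toBilin' k3Gram).restrict ((Matrix.toBilin' k3Gram).orthogonal (ℤ ∙ ℓ))) ↦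
        g.discriminantGroupCongr = g'.discriminantGroupCongr)) = 2 ^ d.primeFactors.card := by
  have hℓ0 : ℓ ≠ 0 := by
    intro h0
    subst h0
    simp only [map_zero] at hℓ
    omega
  obtain ⟨hsC, heC, hC⟩ := k3Lattice_restrict_orthogonal_isEven_nondegenerate hℓ (by exact_mod_cast hd.ne') hℓsat
  obtain ⟨e⟩ := k3Lattice_restrict_orthogonal_equivalent hℓ hℓ0 hℓsat
  obtain ⟨hQ, hsQ, heQ⟩ := nondegenerate_isSymm_isEven_neg_twoMul_smul_mul_prod_pi_neg_e8Form d hd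
  obtain ⟨e'⟩ := latticeL2d_equivalent_prod_hyperbolicSum d
  rw [natCard_quot_isometryEquiv_eq_natCard_discriminantIsometry _ hC hsC heC _ hQ hsQ heQ (by norm_num : 0 < 2)
    ⟨e.trans e'⟩]
  exact natCard_discriminantIsometry_restrict_orthogonal d _ isSymm_toBilin'_k3Gram isUnimodular_toBilin'_k3Gram
    isEven_toBilin'_k3Gram hd hℓ hℓsat hC hsC heC

/-- **`|O(q_{L_{2d}})| = 2^{ρ(d)}`** for the model lattice `L_{2d} = E₈(−1)^{⊕2} ⊕ U^{⊕2} ⊕ ℤ(−2d)` (`d ≥ 1`) —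
"From this it follows also that `|O(A_{L_{2d}})| = 2^{ρ(d)}`" (via `L_{2d} ≅ ℓ^⊥ ⊂ Λ_{K3}` for a primitive `ℓ` with
`(ℓ)² = 2d`, Cor. 14.1.10 / Ex. 14.1.11 (i)). [cite: GritsenkoHulekSankaran2007HM, §4 after Lemma 4.3] [cite: Huybrechts2016K3, Ch. 14 Example 1.11 (i)] -/
theorem natCard_discriminantIsometry_latticeL2d (hd : 0 < d)
    (h₁ : (((LinearMap.BilinForm.pi fun _ : Fin 2 ↦ -e8Form).prod (hyperbolicSum 2)).prod
        ((-(2 * d : ℤ)) • LinearMap.mul ℤ ℤ)).Nondegenerate)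
    (h₂ : (((LinearMap.BilinForm.pi fun _ : Fin 2 ↦ -e8Form).prod (hyperbolicSum 2)).prod
        ((-(2 * d : ℤ)) • LinearMap.mul ℤ ℤ)).IsSymm)
    (h₃ : (((LinearMap.BilinForm.pi fun _ : Fin 2 ↦ -e8Form).prod (hyperbolicSum 2)).prod
        ((-(2 * d : ℤ)) • LinearMap.mul ℤ ℤ)).IsEven) :
    Nat.card {σ : (((LinearMap.BilinForm.pi fun _ : Fin 2 ↦ -e8Form).prod (hyperbolicSum 2)).prod
          ((-(2 * d : ℤ)) • LinearMap.mul ℤ ℤ)).discriminantGroup ≃ₗ[ℤ]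
        (((LinearMap.BilinForm.pi fun _ : Fin 2 ↦ -e8Form).prod (hyperbolicSum 2)).prod
          ((-(2 * d : ℤ)) • LinearMap.mul ℤ ℤ)).discriminantGroup //
        ∀ a, (((LinearMap.BilinForm.pi fun _ : Fin 2 ↦ -e8Form).prod (hyperbolicSum 2)).prod
            ((-(2 * d : ℤ)) • LinearMap.mul ℤ ℤ)).discriminantQuad h₁ h₂ h₃ (σ a) =
          (((LinearMap.BilinForm.pi fun _ : Fin 2 ↦ -e8Form).prod (hyperbolicSum 2)).prod
            ((-(2 * d : ℤ)) • LinearMap.mul ℤ ℤ)).discriminantQuad h₁ h₂ h₃ a} = 2 ^ d.primeFactors.card := by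
  obtain ⟨ℓ, hℓ, hℓ0, hℓsat⟩ := k3Lattice_exists_primitive_sq_eq (d : ℤ)
  obtain ⟨hsC, heC, hC⟩ := k3Lattice_restrict_orthogonal_isEven_nondegenerate hℓ (by exact_mod_cast hd.ne') hℓsat
  obtain ⟨e⟩ := k3Lattice_restrict_orthogonal_equivalent hℓ hℓ0 hℓsat
  rw [← natCard_discriminantIsometry_eq_of_isometryEquiv _ _ e hC hsC heC h₁ h₂ h₃]
  exact natCard_discriminantIsometry_restrict_orthogonal d _ isSymm_toBilin'_k3Gram isUnimodular_toBilin'_k3Gram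
    isEven_toBilin'_k3Gram hd hℓ hℓsat hC hsC heC

/-- **GHS for the model: `[O(L_{2d}) : Õ(L_{2d})] = 2^{ρ(d)}`** (`d ≥ 1`): the classes of `O(L_{2d})` with the same
action on the discriminant group number `2^{ρ(d)}`. [cite: GritsenkoHulekSankaran2007HM, §4 Lemmas 4.2, 4.3] -/
theorem natCard_quot_isometryEquiv_latticeL2d (hd : 0 < d) :
    Nat.card (Quot (fun g g' : (((LinearMap.BilinForm.pi fun _ : Fin 2 ↦ -e8Form).prod (hyperbolicSum 2)).prod
          ((-(2 * d : ℤ)) • LinearMap.mul ℤ ℤ)).IsometryEquiv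
        (((LinearMap.BilinForm.pi fun _ : Fin 2 ↦ -e8Form).prod (hyperbolicSum 2)).prod
          ((-(2 * d : ℤ)) • LinearMap.mul ℤ ℤ)) ↦
        g.discriminantGroupCongr = g'.discriminantGroupCongr)) = 2 ^ d.primeFactors.card := by
  obtain ⟨hQ, hsQ, heQ⟩ := nondegenerate_isSymm_isEven_neg_twoMul_smul_mul_prod_pi_neg_e8Form d hd
  obtain ⟨e⟩ := latticeL2d_equivalent_prod_hyperbolicSum d
  have h₁ := e.symm.nondegenerate (hQ.prod (isUnimodular_hyperbolicSum 2).nondegenerate)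
  have h₂ := e.symm.isSymm (hsQ.prod (isSymm_hyperbolicSum 2))
  have h₃ := e.symm.isEven (isEven_prod_iff.2 ⟨heQ, isEven_hyperbolicSum 2⟩)
  rw [natCard_quot_isometryEquiv_eq_natCard_discriminantIsometry _ h₁ h₂ h₃ _ hQ hsQ heQ (by norm_num : 0 < 2) ⟨e⟩]
  exact natCard_discriminantIsometry_latticeL2d d hd h₁ h₂ h₃

end K3

end Literature.Topology.FourManifolds

end
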